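import Summits.QuantumFields.GaugeBoot.DiagonalRPTorusEvenHalfGauge
import Summits.QuantumFields.GaugeBoot.ClassFunctionConvolution
import HarnessLib

/-!
# Diagonal RP on the even two-torus, gauge-invariant sector, all couplings — II: the back layer
(gauge-boot, L3 supplement)

HONEST FRAMING (cell `pub-gaugeboot`, page 1 of every file): the venture produces certified bounds
on lattice expectations at stated coupling, gauge group, dimension and torus size; NOT a mass gap,
NOT a continuum limit, NOT a string tension; NOT Yang–Mills-summit-bearing (barriers
`FixedCouplingUltralocality`, `PerturbativeInvisibility`). This module is part of a POSITIVE
structural result (`DiagonalRPTorusEvenGaugeInvariantAllGroups.lean`): on `(ℤ/L)²`, `L ≥ 4` even,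
closed-half diagonal reflection positivity HOLDS for gauge-invariant observables at EVERY real `β`
for EVERY compact metrisable gauge group.

Geometry of the second cut layer `k = c = L/2` of the even torus, companion of the mirror layer
`k = 0` of `DiagonalRPTorusOddStaircase.lean` (`dg t = (t,t)`, `stairC`, `stairD`):

* `dgc i t` — the `t`-th back-layer site (`i`-coordinate `t + c`, other coordinate `t`);
  `kd_dgc`, `dgc_shift_shift` (`D_{dgc t}` runs from `dgc t` to `dgc (t+1)`), `Sc_eq_image_dgc`,
  `sum_Sc_eq_sum_range`, `siteDiagSwap_dgc` (the swap is the half-turn `t ↦ t + c` of the layer);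
* `stairDc n U = D_{dgc 0} ⋯ D_{dgc (n-1)}` (closed-half side), `stairCc n U = C_{dgc 0} ⋯ C_{dgc (n-1)}`;
* the staircases of both layers under half-gauge transformations (`stairC_halfGauge`:
  conjugation at the two ends; `stairD_halfGauge`, `stairCc_halfGauge`: untouched;
  `stairDc_halfGauge`; bumps on the other layer are invisible).

* `dg_ne_dg`, `dgc_ne_dgc` (distinct sites along the layers) and two more items of the
  convolution calculus of `ClassFunctionConvolution.lean`: `ClassConv.apply_mul_comm` and the
  ★ gluing step `ClassConv.integral_glue`: `∫ u(A x⁻¹ B⁻¹) w(x C D⁻¹) dx = (u ⋆ w)(A C D⁻¹ B⁻¹)`.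

All statements are elementary bookkeeping. [folklore]
-/

open MeasureTheory Complex Finset Function
open scoped ComplexOrder ENNReal

namespace Summit.QuantumFields.GaugeBoot

open Literature.MathematicalPhysics.QuantumFieldTheory
open Literature.RepresentationTheory.CompactGroups

noncomputable section

/-! ## Two more items of the convolution calculus -/

namespace ClassConv

variable {G : Type*} [Group G] [TopologicalSpace G] [IsTopologicalGroup G] [CompactSpace G]
  [MeasurableSpace G] [BorelSpace G]

omit [TopologicalSpace G] [IsTopologicalGroup G] [CompactSpace G] [MeasurableSpace G] [BorelSpace G] in
/-- A class function is symmetric in the factors of a product: `u(a b) = u(b a)`. [folklore] -/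
theorem apply_mul_comm {u : G → ℝ} (hu : ∀ g k, u (g * k * g⁻¹) = u k) (a b : G) :
    u (a * b) = u (b * a) := by
  rw [← hu b (a * b)]; congr 1; group

/-- ★ **The gluing step**: averaging a bump shared by two consecutive factors convolves them,
`∫ u(A x⁻¹ B⁻¹) w(x C D⁻¹) dx = (u ⋆ w)(A C D⁻¹ B⁻¹)` (`u` a class function). [folklore] -/
theorem integral_glue {u w : G → ℝ} (hu : ∀ g k, u (g * k * g⁻¹) = u k)
    (hw : ∀ g k, w (g * k * g⁻¹) = w k) (A B C D : G) :
    ∫ x, u (A * x⁻¹ * B⁻¹) * w (x * C * D⁻¹) ∂(haarProbability G) = conv u w (A * C * D⁻¹ * B⁻¹) := by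
  have h1 : ∀ x : G, u (A * x⁻¹ * B⁻¹) * w (x * C * D⁻¹) = u (B⁻¹ * A * x⁻¹) * w (x * (C * D⁻¹)) :=
    fun x => by rw [show A * x⁻¹ * B⁻¹ = (A * x⁻¹) * B⁻¹ by rfl, apply_mul_comm hu, ← mul_assoc, mul_assoc x]
  simp_rw [h1]
  rw [integral_mul_inv_mul_eq_conv, show B⁻¹ * A * (C * D⁻¹) = B⁻¹ * (A * C * D⁻¹) by group,
    apply_mul_comm (conv_conj hu hw)]

end ClassConv

namespace DiagRPTwo

/-! ## The back-layer sites `dgc t` and the back-layer staircases -/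

section BackLayer

variable {L : ℕ} {i j : Fin 2}

variable (i) in
/-- The `t`-th site of the back layer: `i`-coordinate `t + c`, the other coordinate `t`
(`c = L/2`). -/
def dgc (t : ℕ) : Site 2 L := fun k => if k = i then (t : ZMod L) + cc L else (t : ZMod L)

/-- Back-layer sites have diagonal coordinate `c`. -/
@[simp] theorem kd_dgc (hij : i ≠ j) (t : ℕ) : kd i j (dgc i t : Site 2 L) = cc L := by
  simp [kd, dgc, hij.symm]

/-- `dgc t + e_j + e_i = dgc (t + 1)`. -/
theorem dgc_shift_shift (hij : i ≠ j) (t : ℕ) :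
    ((dgc i t : Site 2 L).shift j).shift i = dgc i (t + 1) := by
  funext k
  simp only [Site.shift, dgc, Pi.add_apply, Pi.single_apply, Nat.cast_add, Nat.cast_one]
  rcases eq_or_eq_of_ne hij k with rfl | rfl
  · simp [hij]; ring
  · simp [hij.symm]

/-- The back layer closes up after `L` steps. -/
@[simp] theorem dgc_self (L : ℕ) (i : Fin 2) : (dgc i L : Site 2 L) = dgc i 0 := by
  funext k; simp [dgc]

/-- The back-layer sites are `L`-periodic. -/
theorem dgc_add_L (t : ℕ) : (dgc i (t + L) : Site 2 L) = dgc i t := by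
  funext k; simp [dgc]

/-- `dgc` is injective on `[0, L)` (`i ≠ j`). -/
theorem dgc_injOn [NeZero L] (hij : i ≠ j) :
    Set.InjOn (dgc i : ℕ → Site 2 L) (Finset.range L : Set ℕ) := by
  intro s hs t ht h
  have h0 := congrFun h j
  simp only [dgc, hij.symm, ↓reduceIte] at h0
  have := congrArg ZMod.val h0
  rwa [ZMod.val_natCast, ZMod.val_natCast, Nat.mod_eq_of_lt (Finset.mem_range.1 hs),
    Nat.mod_eq_of_lt (Finset.mem_range.1 ht)] at this

/-- A back-layer site is `dgc` of its `j`-coordinate. -/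
theorem eq_dgc_of_kd_eq_cc [NeZero L] (hij : i ≠ j) {y : Site 2 L} (hy : kd i j y = cc L) :
    y = dgc i (y j).val := by
  have h : y i = y j + cc L := by rw [← hy, kd]; ring
  funext k
  simp only [dgc, ZMod.natCast_zmod_val]
  rcases eq_or_eq_of_ne hij k with rfl | rfl
  · simp [h]
  · simp [hij.symm]

/-- The back-layer plaquettes are exactly the `dgc t`, `t < L` (`L ≥ 4`). -/
theorem Sc_eq_image_dgc [NeZero L] (h4 : 4 ≤ L) (hij : i ≠ j) :
    Sc (L := L) i j = (Finset.range L).image (dgc i) := by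
  ext y
  rw [mem_Sc, Finset.mem_image]
  constructor
  · intro hy
    have hk : kd i j y = cc L := (kd_eq_cc_iff h4 y).2 hy
    exact ⟨(y j).val, Finset.mem_range.2 (ZMod.val_lt _), (eq_dgc_of_kd_eq_cc hij hk).symm⟩
  · rintro ⟨t, -, rfl⟩
    rw [kd_dgc hij, cc_val h4]

/-- Sums over the back layer are sums over `t < L`. -/
theorem sum_Sc_eq_sum_range [NeZero L] (h4 : 4 ≤ L) (hij : i ≠ j) {M : Type*} [AddCommMonoid M]
    (f : Site 2 L → M) : ∑ y ∈ Sc i j, f y = ∑ t ∈ Finset.range L, f (dgc i t) := by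
  rw [Sc_eq_image_dgc h4 hij, Finset.sum_image fun s hs t ht h => dgc_injOn hij hs ht h]

/-- The swap acts on the back layer as the half-turn `dgc t ↦ dgc (t + c)` (`L` even). -/
theorem siteDiagSwap_dgc [NeZero L] (hL : Even L) (hij : i ≠ j) (t : ℕ) :
    siteDiagSwap i j (dgc i t : Site 2 L) = dgc i (t + L / 2) := by
  have hcc : ((L / 2 : ℕ) : ZMod L) = cc L := rfl
  funext k
  simp only [siteDiagSwap, dgc, Nat.cast_add, hcc]
  rcases eq_or_eq_of_ne hij k with rfl | rfl
  · rw [Equiv.swap_apply_left, if_neg hij.symm, if_pos rfl, add_assoc, cc_add_cc hL, add_zero]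
  · rw [Equiv.swap_apply_right, if_pos rfl, if_neg hij.symm]

variable {G : Type*} [Group G]

variable (i j) in
/-- `stairDc n U = D_{dgc 0} ⋯ D_{dgc (n-1)}`: the back-layer staircase on the closed-half side. -/
def stairDc (n : ℕ) (U : GaugeConfig 2 L G) : G := ((List.range n).map fun t => dT i j U (dgc i t)).prod

variable (i j) in
/-- `stairCc n U = C_{dgc 0} ⋯ C_{dgc (n-1)}`: the back-layer staircase on the opposite side. -/
def stairCc (n : ℕ) (U : GaugeConfig 2 L G) : G := ((List.range n).map fun t => cT i j U (dgc i t)).prod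

/-- No steps. -/
@[simp] theorem stairDc_zero (U : GaugeConfig 2 L G) : stairDc i j 0 U = 1 := by simp [stairDc]
/-- No steps. -/
@[simp] theorem stairCc_zero (U : GaugeConfig 2 L G) : stairCc i j 0 U = 1 := by simp [stairCc]

/-- One more step. -/
theorem stairDc_succ (n : ℕ) (U : GaugeConfig 2 L G) :
    stairDc i j (n + 1) U = stairDc i j n U * dT i j U (dgc i n) := by
  simp [stairDc, List.range_succ, List.map_append, List.prod_append]

/-- One more step. -/
theorem stairCc_succ (n : ℕ) (U : GaugeConfig 2 L G) :
    stairCc i j (n + 1) U = stairCc i j n U * cT i j U (dgc i n) := by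
  simp [stairCc, List.range_succ, List.map_append, List.prod_append]

variable [TopologicalSpace G] [IsTopologicalGroup G]

/-- The mirrored staircase is continuous. -/
theorem continuous_stairD (n : ℕ) : Continuous fun U : GaugeConfig 2 L G => stairD i j n U := by
  induction n with
  | zero => simp only [stairD_zero]; exact continuous_const
  | succ n ih => simp only [stairD_succ]; exact ih.mul (continuous_dT _)

/-- The back-layer staircase is continuous. -/
theorem continuous_stairDc (n : ℕ) : Continuous fun U : GaugeConfig 2 L G => stairDc i j n U := by
  induction n with
  | zero => simp only [stairDc_zero]; exact continuous_const
  | succ n ih => simp only [stairDc_succ]; exact ih.mul (continuous_dT _)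

/-- The opposite back-layer staircase is continuous. -/
theorem continuous_stairCc (n : ℕ) : Continuous fun U : GaugeConfig 2 L G => stairCc i j n U := by
  induction n with
  | zero => simp only [stairCc_zero]; exact continuous_const
  | succ n ih => simp only [stairCc_succ]; exact ih.mul (continuous_cT _)

end BackLayer

/-! ## Staircases under half-gauge transformations -/

section StairGauge

variable {L : ℕ} [NeZero L] {G : Type*} [Group G] {i j : Fin 2}

/-- The mirror staircase under a half-gauge transformation: conjugation at its two ends. -/
theorem stairC_halfGauge (h4 : 4 ≤ L) (hij : i ≠ j) (z : Site 2 L) (x : G) (n : ℕ)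
    (U : GaugeConfig 2 L G) :
    stairC i j n (halfGauge i j z x U) =
      bump z x (dg 0) * stairC i j n U * (bump z x (dg n))⁻¹ := by
  induction n with
  | zero => simp
  | succ n ih =>
    rw [stairC_succ, stairC_succ, ih, cT_halfGauge_of_kd_zero h4 hij z x U (kd_dg i j n),
      dg_shift_shift hij]
    group

/-- The mirrored staircase is untouched by half-gauge transformations. -/
theorem stairD_halfGauge (h4 : 4 ≤ L) (hij : i ≠ j) (z : Site 2 L) (x : G) (n : ℕ)
    (U : GaugeConfig 2 L G) : stairD i j n (halfGauge i j z x U) = stairD i j n U := by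
  induction n with
  | zero => simp
  | succ n ih => rw [stairD_succ, stairD_succ, ih, dT_halfGauge_of_kd_zero h4 hij z x U (kd_dg i j n)]

/-- The back-layer staircase under a half-gauge transformation: conjugation at its two ends. -/
theorem stairDc_halfGauge (h4 : 4 ≤ L) (hij : i ≠ j) (z : Site 2 L) (x : G) (n : ℕ)
    (U : GaugeConfig 2 L G) :
    stairDc i j n (halfGauge i j z x U) =
      bump z x (dgc i 0) * stairDc i j n U * (bump z x (dgc i n))⁻¹ := by
  induction n with
  | zero => simp
  | succ n ih =>
    rw [stairDc_succ, stairDc_succ, ih, dT_halfGauge_of_kd_cc h4 hij z x U (kd_dgc hij n),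
      dgc_shift_shift hij]
    group

/-- The opposite back-layer staircase is untouched (`L ≥ 4` even). -/
theorem stairCc_halfGauge (hL : Even L) (h4 : 4 ≤ L) (hij : i ≠ j) (z : Site 2 L) (x : G)
    (n : ℕ) (U : GaugeConfig 2 L G) : stairCc i j n (halfGauge i j z x U) = stairCc i j n U := by
  induction n with
  | zero => simp
  | succ n ih =>
    rw [stairCc_succ, stairCc_succ, ih, cT_halfGauge_of_kd_cc hL h4 hij z x U (kd_dgc hij n)]

/-- A bump on the back layer is invisible to the mirror staircase. -/
theorem stairC_halfGauge_dgc (h4 : 4 ≤ L) (hij : i ≠ j) (s : ℕ) (x : G) (n : ℕ)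
    (U : GaugeConfig 2 L G) : stairC i j n (halfGauge i j (dgc i s) x U) = stairC i j n U := by
  have hne : ∀ t, (dg t : Site 2 L) ≠ dgc i s := fun t h => by
    have := congrArg (kd i j) h
    rw [kd_dg, kd_dgc hij] at this
    exact cc_ne_zero h4 this.symm
  rw [stairC_halfGauge h4 hij, bump_of_ne (hne 0), bump_of_ne (hne n), one_mul, inv_one, mul_one]

/-- A bump on the mirror is invisible to the back-layer staircase. -/
theorem stairDc_halfGauge_dg (h4 : 4 ≤ L) (hij : i ≠ j) (s : ℕ) (x : G) (n : ℕ)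
    (U : GaugeConfig 2 L G) : stairDc i j n (halfGauge i j (dg s) x U) = stairDc i j n U := by
  have hne : ∀ t, (dgc i t : Site 2 L) ≠ dg s := fun t h => by
    have := congrArg (kd i j) h
    rw [kd_dg, kd_dgc hij] at this
    exact cc_ne_zero h4 this
  rw [stairDc_halfGauge h4 hij, bump_of_ne (hne 0), bump_of_ne (hne n), one_mul, inv_one, mul_one]

end StairGauge

/-! ## Small geometric facts: distinct sites along the two layers -/

section Sites

variable {L : ℕ} [NeZero L] {i j : Fin 2}

/-- Distinct mirror sites: `dg b ≠ dg a` for `0 < a < L`, `a < b ≤ L` (`dg L = dg 0`). -/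
theorem dg_ne_dg {a b : ℕ} (ha0 : 0 < a) (haL : a < L) (hab : a < b) (hbL : b ≤ L) :
    (dg b : Site 2 L) ≠ dg a := by
  intro h
  rcases Nat.lt_or_eq_of_le hbL with hb | hb
  · exact absurd (dg_injOn (Finset.mem_coe.2 (Finset.mem_range.2 hb))
      (Finset.mem_coe.2 (Finset.mem_range.2 haL)) h) (Nat.ne_of_gt hab)
  · rw [hb, dg_self] at h
    exact absurd (dg_injOn (Finset.mem_coe.2 (Finset.mem_range.2 (NeZero.pos L)))
      (Finset.mem_coe.2 (Finset.mem_range.2 haL)) h) (Nat.ne_of_lt ha0)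

/-- Distinct mirror sites below `L`. -/
theorem dg_ne_dg' {a b : ℕ} (haL : a < L) (hbL : b < L) (hab : a ≠ b) : (dg a : Site 2 L) ≠ dg b :=
  fun h => hab (dg_injOn (Finset.mem_coe.2 (Finset.mem_range.2 haL))
    (Finset.mem_coe.2 (Finset.mem_range.2 hbL)) h)

/-- Distinct back-layer sites: `dgc b ≠ dgc a` for `0 < a < L`, `a < b ≤ L`. -/
theorem dgc_ne_dgc (hij : i ≠ j) {a b : ℕ} (ha0 : 0 < a) (haL : a < L) (hab : a < b) (hbL : b ≤ L) :
    (dgc i b : Site 2 L) ≠ dgc i a := by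
  intro h
  rcases Nat.lt_or_eq_of_le hbL with hb | hb
  · exact absurd (dgc_injOn hij (Finset.mem_coe.2 (Finset.mem_range.2 hb))
      (Finset.mem_coe.2 (Finset.mem_range.2 haL)) h) (Nat.ne_of_gt hab)
  · rw [hb, dgc_self] at h
    exact absurd (dgc_injOn hij (Finset.mem_coe.2 (Finset.mem_range.2 (NeZero.pos L)))
      (Finset.mem_coe.2 (Finset.mem_range.2 haL)) h) (Nat.ne_of_lt ha0)

/-- Distinct back-layer sites below `L`. -/
theorem dgc_ne_dgc' (hij : i ≠ j) {a b : ℕ} (haL : a < L) (hbL : b < L) (hab : a ≠ b) :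
    (dgc i a : Site 2 L) ≠ dgc i b :=
  fun h => hab (dgc_injOn hij (Finset.mem_coe.2 (Finset.mem_range.2 haL))
    (Finset.mem_coe.2 (Finset.mem_range.2 hbL)) h)

end Sites

end DiagRPTwo

end

end Summit.QuantumFields.GaugeBoot
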